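import Summits.QuantumFields.QCD.Theses.NestedDissectionSea

/-!
# Sketch — crux idea `parity-descent` (ideator 2, gen 2) for `NegativeCellsDilute` (stmt-QuantumFields-13900)

Exact layer (E): the sign of a block determinant is the mod-2 count of the defect indicators of
its halving tree (pure telescoping of signs; needs only non-vanishing node determinants).
Probabilistic layer (P): `c · P(defect_b) ≤ P(defect_b ∧ block negative) ≤ P(block negative)`
(one-box non-conspiracy) and Bonferroni `P(block negative) ≥ P(N = 1) ≥ E N − E N(N−1)`
(pair-sparsity form).
Transfer (T): `DescentLaw` (C⁺) — block rarity at ONE physical scale + non-conspiracy + the pin,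
in the crux's own `∃ reg … ∀ m ∃ R` prefix.
-/

noncomputable section

namespace Summit.QuantumFields.QCD.Cruxes.NegativeCellsDilute.Ideator2g2

open MeasureTheory Filter Matrix Finset
open scoped Classical BigOperators
open Literature.MathematicalPhysics.QuantumLattice Literature.MathematicalPhysics.QuantumFieldTheory
  Literature.Probability.LatticeModels

/-- Local notation: the colour group `SU(3)`. -/
local notation "𝔾" => Matrix.specialUnitaryGroup (Fin 3) ℂ

/-! ## (E0) Sign of a product of non-zero reals = parity of the number of negative factors -/

theorem prod_neg_iff_odd_card {ι : Type*} [DecidableEq ι] (s : Finset ι) (q : ι → ℝ)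
    (hq : ∀ i ∈ s, q i ≠ 0) :
    (∏ i ∈ s, q i) < 0 ↔ Odd ((s.filter fun i => q i < 0).card) := by
  classical
  induction s using Finset.induction_on with
  | empty => simp
  | @insert a s ha ih =>
    have hqa : q a ≠ 0 := hq a (mem_insert_self a s)
    have hqs : ∀ i ∈ s, q i ≠ 0 := fun i hi => hq i (mem_insert_of_mem hi)
    have hX : (∏ i ∈ s, q i) ≠ 0 := prod_ne_zero_iff.mpr hqs
    rw [prod_insert ha, filter_insert, mul_neg_iff]
    by_cases hneg : q a < 0
    · have hnot : a ∉ s.filter fun i => q i < 0 := fun h => ha (mem_of_mem_filter a h)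
      rw [if_pos hneg, card_insert_of_notMem hnot, Nat.odd_add_one, ← ih hqs]
      constructor
      · rintro (⟨hpos, _⟩ | ⟨_, hXpos⟩)
        · exact absurd hneg (not_lt.mpr hpos.le)
        · exact not_lt.mpr hXpos.le
      · intro hXnn
        exact Or.inr ⟨hneg, lt_of_le_of_ne (not_lt.mp hXnn) (Ne.symm hX)⟩
    · rw [if_neg hneg, ← ih hqs]
      have hpos : 0 < q a := lt_of_le_of_ne (not_lt.mp hneg) (Ne.symm hqa)
      constructor
      · rintro (⟨_, hXneg⟩ | ⟨hneg', _⟩)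
        · exact hXneg
        · exact absurd hneg' hneg
      · intro hXneg
        exact Or.inl ⟨hpos, hXneg⟩

/-- (E1) ONE HALVING STEP. For a non-zero parent value `p` and non-zero children values `q ε`:
the parent is negative iff EXACTLY ONE of "the separator indicator `p · ∏ q < 0` fires" and
"an odd number of children are negative" holds. -/
theorem parent_neg_iff_xor {ι : Type*} [Fintype ι] [DecidableEq ι] (p : ℝ) (q : ι → ℝ)
    (hp : p ≠ 0) (hq : ∀ i, q i ≠ 0) :
    p < 0 ↔ Xor (p * ∏ i, q i < 0) (Odd ((univ.filter fun i => q i < 0).card)) := by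
  have hQ : (∏ i, q i) ≠ 0 := prod_ne_zero_iff.mpr fun i _ => hq i
  have key := prod_neg_iff_odd_card univ q fun i _ => hq i
  rw [← key, mul_neg_iff]
  rcases lt_or_gt_of_ne hQ with hQn | hQp
  · have h1 : ¬ (0 < ∏ i, q i) := not_lt.mpr hQn.le
    constructor
    · intro hpn
      refine Or.inr ⟨hQn, ?_⟩
      rintro (⟨hpp, _⟩ | ⟨_, hQp⟩)
      · exact absurd hpn (not_lt.mpr hpp.le)
      · exact h1 hQp
    · rintro (⟨h, hnot⟩ | ⟨_, hnot⟩)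
      · exact absurd hQn hnot
      · rcases lt_or_gt_of_ne hp with hpn | hpp
        · exact hpn
        · exact absurd (Or.inl ⟨hpp, hQn⟩) hnot
  · have h1 : ¬ (∏ i, q i < 0) := not_lt.mpr hQp.le
    constructor
    · intro hpn
      exact Or.inl ⟨Or.inr ⟨hpn, hQp⟩, h1⟩
    · rintro (⟨h, _⟩ | ⟨hQn, _⟩)
      · rcases h with ⟨_, hQn⟩ | ⟨hpn, _⟩
        · exact absurd hQn h1
        · exact hpn
      · exact absurd hQn h1

/-! ## (E2) The halving tree of a block and its defect count -/

variable {N : ℕ} [NeZero N]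

/-- Number of DEFECT INDICATORS in the depth-`D` halving tree below the box `(x, s)`:
a depth-`0` node (leaf) is a defect iff its Dirichlet determinant is negative; an internal node is
a defect iff (its determinant) × (the sixteen children determinants) is negative — exactly the two
branches of the tree's `IsSignDefect` (leaf `j = 0` / separator `j > 0`). -/
def defectCount (U : GaugeConfig 4 N 𝔾) (μ : ℝ) : ℕ → TorusSite 4 N → (Fin 4 → ℕ) → ℕ
  | 0, x, s => if cellDetRe U μ x s < 0 then 1 else 0
  | D + 1, x, s =>
      (if cellDetRe U μ x s * ∏ ε : Fin 4 → Bool, cellDetRe U μ (childCorner x s ε) (halfSides s ε) < 0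
        then 1 else 0) +
        ∑ ε : Fin 4 → Bool, defectCount U μ D (childCorner x s ε) (halfSides s ε)

/-- No node determinant of the depth-`D` tree vanishes (generic in the gauge field and in `μ`). -/
def TreeNondegenerate (U : GaugeConfig 4 N 𝔾) (μ : ℝ) : ℕ → TorusSite 4 N → (Fin 4 → ℕ) → Prop
  | 0, x, s => cellDetRe U μ x s ≠ 0
  | D + 1, x, s => cellDetRe U μ x s ≠ 0 ∧
      ∀ ε : Fin 4 → Bool, TreeNondegenerate U μ D (childCorner x s ε) (halfSides s ε)

theorem TreeNondegenerate.root {U : GaugeConfig 4 N 𝔾} {μ : ℝ} :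
    ∀ {D : ℕ} {x : TorusSite 4 N} {s : Fin 4 → ℕ}, TreeNondegenerate U μ D x s → cellDetRe U μ x s ≠ 0
  | 0, _, _, h => h
  | _ + 1, _, _, h => h.1

/-- Parity of a natural-number sum = parity of the number of odd summands (Mathlib
`Finset.odd_sum_iff_odd_card_odd`). -/
theorem odd_sum_iff_odd_card_filter_odd {ι : Type*} [DecidableEq ι] (s : Finset ι) (f : ι → ℕ) :
    Odd (∑ i ∈ s, f i) ↔ Odd ((s.filter fun i => Odd (f i)).card) := by
  classical
  simpa using Finset.odd_sum_iff_odd_card_odd (s := s) f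

/-- **(E2) BLOCK PARITY TELESCOPE** — the exact identity the lever rests on: a block is negative
iff its halving tree carries an ODD number of defect indicators. One defect with everything else
even makes the block negative; conversely a negative block certifies an odd number of defects.
(Statement; the proof is the induction on `D` with `parent_neg_iff_xor` and
`odd_sum_iff_odd_card_filter_odd` — provable now, size S–M.) -/
def BlockParityTelescope : Prop :=
  ∀ (N : ℕ) [NeZero N] (U : GaugeConfig 4 N 𝔾) (μ : ℝ) (D : ℕ) (x : TorusSite 4 N) (s : Fin 4 → ℕ),
    TreeNondegenerate U μ D x s → (cellDetRe U μ x s < 0 ↔ Odd (defectCount U μ D x s))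

/-- The depth-`0` case of the telescope (proved). -/
theorem blockParityTelescope_zero (U : GaugeConfig 4 N 𝔾) (μ : ℝ) (x : TorusSite 4 N)
    (s : Fin 4 → ℕ) : cellDetRe U μ x s < 0 ↔ Odd (defectCount U μ 0 x s) := by
  unfold defectCount
  by_cases h : cellDetRe U μ x s < 0 <;> simp [h]

/-- **(E2′) the telescope, proved** by induction on the depth. -/
theorem blockNeg_iff_odd_defectCount (U : GaugeConfig 4 N 𝔾) (μ : ℝ) :
    ∀ (D : ℕ) (x : TorusSite 4 N) (s : Fin 4 → ℕ), TreeNondegenerate U μ D x s →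
      (cellDetRe U μ x s < 0 ↔ Odd (defectCount U μ D x s))
  | 0, x, s, _ => blockParityTelescope_zero U μ x s
  | D + 1, x, s, hnd => by
      obtain ⟨hroot, hkids⟩ := hnd
      have ih : ∀ ε, (cellDetRe U μ (childCorner x s ε) (halfSides s ε) < 0 ↔
          Odd (defectCount U μ D (childCorner x s ε) (halfSides s ε))) :=
        fun ε => blockNeg_iff_odd_defectCount U μ D _ _ (hkids ε)
      have hq : ∀ ε, cellDetRe U μ (childCorner x s ε) (halfSides s ε) ≠ 0 :=
        fun ε => (hkids ε).root
      rw [parent_neg_iff_xor _ _ hroot hq]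
      show _ ↔ Odd ((if cellDetRe U μ x s *
          ∏ ε : Fin 4 → Bool, cellDetRe U μ (childCorner x s ε) (halfSides s ε) < 0 then 1 else 0) +
        ∑ ε : Fin 4 → Bool, defectCount U μ D (childCorner x s ε) (halfSides s ε))
      rw [add_comm, Nat.odd_add, odd_sum_iff_odd_card_filter_odd]
      have hfilt : (univ.filter fun ε => Odd (defectCount U μ D (childCorner x s ε) (halfSides s ε))) =
          (univ.filter fun ε => cellDetRe U μ (childCorner x s ε) (halfSides s ε) < 0) := by
        ext ε; simp only [mem_filter, mem_univ, true_and]; exact (ih ε).symm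
      rw [hfilt]
      by_cases hsep : cellDetRe U μ x s *
          ∏ ε : Fin 4 → Bool, cellDetRe U μ (childCorner x s ε) (halfSides s ε) < 0
      · simp only [hsep, if_true]
        constructor
        · rintro (⟨_, hno⟩ | ⟨_, hno⟩)
          · exact ⟨fun ho => absurd ho hno, fun he => absurd he (by decide)⟩
          · exact absurd trivial hno
        · intro h
          exact Or.inl ⟨trivial, fun ho => absurd (h.mp ho) (by decide)⟩
      · simp only [hsep, if_false]
        constructor
        · rintro (⟨hf, _⟩ | ⟨ho, _⟩)
          · exact absurd hf not_false
          · exact ⟨fun _ => ⟨0, rfl⟩, fun _ => ho⟩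
        · intro h
          exact Or.inr ⟨h.mpr ⟨0, rfl⟩, not_false⟩

theorem blockParityTelescope_holds : BlockParityTelescope :=
  fun N _ U μ D x s h => blockNeg_iff_odd_defectCount (N := N) U μ D x s h

/-- **(E3) ONE DEFECT FLIPS THE BLOCK** (the inclusion actually used downstream, one-level form,
proved): if the corner-`x` box is NOT negative while its separator indicator fires, then an odd
number of its children are negative — i.e. a separator defect inside a positive parent is always
accompanied by another negative node one level down. Contrapositive of "a lone defect makes the
parent negative". -/
theorem sep_defect_in_pos_parent_forces_odd_children (U : GaugeConfig 4 N 𝔾) (μ : ℝ)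
    (x : TorusSite 4 N) (s : Fin 4 → ℕ) (hp : cellDetRe U μ x s ≠ 0)
    (hq : ∀ ε : Fin 4 → Bool, cellDetRe U μ (childCorner x s ε) (halfSides s ε) ≠ 0)
    (hsep : cellDetRe U μ x s * ∏ ε, cellDetRe U μ (childCorner x s ε) (halfSides s ε) < 0)
    (hpos : ¬ cellDetRe U μ x s < 0) :
    Odd ((univ.filter fun ε : Fin 4 → Bool =>
      cellDetRe U μ (childCorner x s ε) (halfSides s ε) < 0).card) := by
  have h := parent_neg_iff_xor (cellDetRe U μ x s)
    (fun ε : Fin 4 → Bool => cellDetRe U μ (childCorner x s ε) (halfSides s ε)) hp hq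
  by_contra hodd
  exact hpos (h.mpr (Or.inl ⟨hsep, hodd⟩))

/-! ## (P) The probabilistic step: descent from one-box non-conspiracy (proved, pure arithmetic) -/

/-- If `c · P(A) ≤ P(A ∩ Bneg)` and `P(A ∩ Bneg) ≤ P(Bneg) ≤ p` then `P(A) ≤ p / c`. Stated over
reals (the crux's `P` is a real ratio of integrals). -/
theorem descent_of_nonconspiracy {PA PAB PB p c : ℝ} (hc : 0 < c) (hNC : c * PA ≤ PAB)
    (hmono : PAB ≤ PB) (hU : PB ≤ p) : PA ≤ p / c := by
  rw [le_div_iff₀ hc]; nlinarith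

/-- Bonferroni form (pair sparsity): with `P(Bneg) ≥ P(N = 1) ≥ Σ_b P(A_b) − Σ_{b ≠ b'} P(A_b ∩ A_b')`
and `Σ_{b≠b'} P(A_b ∩ A_b') ≤ (1 − c) Σ_b P(A_b)`, one gets `c Σ_b P(A_b) ≤ P(Bneg)`. -/
theorem descent_of_pair_sparsity {EN ENN1 PB c : ℝ} (hB : EN - ENN1 ≤ PB)
    (hpairs : ENN1 ≤ (1 - c) * EN) : c * EN ≤ PB := by nlinarith

/-! ## (T) The transfer C⁺ = `DescentLaw`, typed in the crux's own prefix

(NC) one-box non-conspiracy for every window box and every admissible host block `(0, 2ⁿ·s)` of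
physical sides in `[R′, 8R′]`; (U) block rarity with the log rate `J_k · P(block negative) ≤ ε`
eventually; (b) the pin verbatim. `DescentLaw → NegativeCellsDilute` is then logic + the
arithmetic of `descent_of_nonconspiracy` + existence of an admissible `n` (uses `ℓ ≤ R′`,
`8R′ ≤ R`, `s_max < 4 s_min`). -/
def DescentLaw : Prop :=
  ∀ Nf : ℕ, (Nf = 2 ∨ Nf = 3) → ∃ reg : QCDRegularisation Nf, reg.HasMassScaling ∧
    (reg.scheme 0 0 0).HasAsymptoticScaling ∧ ∃ M₀ : ℝ, 0 ≤ M₀ ∧ ∃ b₀ : ℕ, 2 ≤ b₀ ∧ ∃ ℓ : ℝ, 0 < ℓ ∧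
    ∃ c : ℝ, 0 < c ∧
    ∀ m : Fin Nf → ℝ, (∀ f, M₀ < m f) → ∃ R : ℝ, 0 < R ∧ ∃ R' : ℝ, ℓ ≤ R' ∧ 8 * R' ≤ R ∧
    -- (NC) non-conspiracy: given a window defect, its physical host block is negative w.p. ≥ c
    (∀ᶠ k : ℕ in Filter.atTop, ∀ S : ℕ, R ≤ reg.a k * (2 * S + 1) →
      let N : ℕ := 2 * S + 1
      let mq : Fin Nf → ℝ := fun f => reg.mcrit k + reg.a k * m f / reg.Zm k
      let wt : GaugeConfig 4 N (Matrix.specialUnitaryGroup (Fin 3) ℂ) → ℝ :=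
        fun U => ∏ f, ‖fermionDet (wilsonDirac (fundamentalRep (Fin 3)) U (mq f) 1)‖
      let P : (GaugeConfig 4 N (Matrix.specialUnitaryGroup (Fin 3) ℂ) → Prop) → ℝ := fun E =>
        (∫ U, (if E U then (1 : ℝ) else 0) * wt U
            ∂(wilsonMeasure (d := 4) (L := N) (fundamentalRep (Fin 3)) (reg.β k))) /
          (∫ U, wt U ∂(wilsonMeasure (d := 4) (L := N) (fundamentalRep (Fin 3)) (reg.β k)))
      let J : ℕ := Nat.log 2 (⌊ℓ / reg.a k⌋₊ / b₀) + 1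
      ∀ j < J, ∀ s : Fin 4 → ℕ,
        (∀ i, b₀ * 2 ^ j ≤ s i ∧ s i < b₀ * 2 ^ (j + 2) ∧ s i ≤ N ∧ (s i : ℝ) * reg.a k ≤ ℓ) →
        ∀ n : ℕ, (∀ i, R' ≤ (2 ^ n * s i : ℕ) * reg.a k ∧ ((2 ^ n * s i : ℕ) : ℝ) * reg.a k ≤ 8 * R') →
        ∀ f : Fin Nf,
          c * P (fun U => IsSignDefect U (mq f) j s) ≤
            P (fun U => IsSignDefect U (mq f) j s ∧ cellDetRe U (mq f) 0 (fun i => 2 ^ n * s i) < 0)) ∧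
    -- (U) block rarity at the physical scale R′, with the log rate
    (∀ ε : ℝ, 0 < ε → ∀ᶠ k : ℕ in Filter.atTop, ∀ S : ℕ, R ≤ reg.a k * (2 * S + 1) →
      let N : ℕ := 2 * S + 1
      let mq : Fin Nf → ℝ := fun f => reg.mcrit k + reg.a k * m f / reg.Zm k
      let wt : GaugeConfig 4 N (Matrix.specialUnitaryGroup (Fin 3) ℂ) → ℝ :=
        fun U => ∏ f, ‖fermionDet (wilsonDirac (fundamentalRep (Fin 3)) U (mq f) 1)‖
      let P : (GaugeConfig 4 N (Matrix.specialUnitaryGroup (Fin 3) ℂ) → Prop) → ℝ := fun E =>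
        (∫ U, (if E U then (1 : ℝ) else 0) * wt U
            ∂(wilsonMeasure (d := 4) (L := N) (fundamentalRep (Fin 3)) (reg.β k))) /
          (∫ U, wt U ∂(wilsonMeasure (d := 4) (L := N) (fundamentalRep (Fin 3)) (reg.β k)))
      let J : ℕ := Nat.log 2 (⌊ℓ / reg.a k⌋₊ / b₀) + 1
      ∀ S' : Fin 4 → ℕ, (∀ i, R' ≤ (S' i : ℝ) * reg.a k ∧ (S' i : ℝ) * reg.a k ≤ 8 * R' ∧ S' i ≤ N) →
        ∀ f : Fin Nf, (J : ℝ) * P (fun U => cellDetRe U (mq f) 0 S' < 0) ≤ ε) ∧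
    -- (b) the parity pin, verbatim from the crux
    (∀ M : ℝ, M₀ < M → ∀ᶠ k : ℕ in Filter.atTop, ∀ S : ℕ, R ≤ reg.a k * (2 * S + 1) →
      let N : ℕ := 2 * S + 1
      let mq : Fin Nf → ℝ := fun f => reg.mcrit k + reg.a k * m f / reg.Zm k
      let wt : GaugeConfig 4 N (Matrix.specialUnitaryGroup (Fin 3) ℂ) → ℝ :=
        fun U => ∏ f, ‖fermionDet (wilsonDirac (fundamentalRep (Fin 3)) U (mq f) 1)‖
      (1 / 4 : ℝ) ≤
        (∫ U, (if (fermionDet (wilsonDirac (fundamentalRep (Fin 3)) U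
              (reg.mcrit k - reg.a k * M / reg.Zm k) 1)).re < 0 then (1 : ℝ) else 0) * wt U
            ∂(wilsonMeasure (d := 4) (L := N) (fundamentalRep (Fin 3)) (reg.β k))) /
          (∫ U, wt U ∂(wilsonMeasure (d := 4) (L := N) (fundamentalRep (Fin 3)) (reg.β k))))

/-- The glue target of the line (statement only; the crux-plan seat proves it as `NegativeCellsDilute_of`):
union bound over the `≤ 3` flavours, `descent_of_nonconspiracy` per box with `p = ε c/(3J)`,
`δ_j := ε / J`. -/
def DiluteOfDescent : Prop :=
  DescentLaw → Summit.QuantumFields.QCD.Theses.NestedDissectionSea.NegativeCellsDilute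

end Summit.QuantumFields.QCD.Cruxes.NegativeCellsDilute.Ideator2g2

end
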